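import Summits.Langlands.Langlands.Theses.QuarterDeficit1951
import Literature.NumberTheory.GaloisRepresentations.GaloisRepUnramifiedProofs
import Literature.NumberTheory.GaloisRepresentations.TateUnramifiedLiftingHolds
import Literature.NumberTheory.GaloisRepresentations.DirichletCharacterOfGaloisCharacter
import Literature.FieldTheory.AlgClosed.PadicAlgClEquivComplex
import Literature.NumberTheory.Automorphic.BCDTTheoremBWildAtThreeDet
import Literature.NumberTheory.NumberFields.QuinticRing

/-!
# Route `QuarterDeficit1951` (Langlands) — crux `IcosahedralSupply`: stub `stub_dmEvenOrderThree`

Line `Sketch`.  For the five roots `θ i ∈ ℤ̄` of the Doud–Moore quintic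
`f = x⁵ − x⁴ − 780x³ + 9911x² − 24208x + 15952` and the permutation representation
`e₀ : Γ_ℚ → S₅` on them:

* (i) **the image is even**: `sign ∘ e₀ : Γ_ℚ → {±1} ⊆ ℂˣ` has open kernel and is trivial on every
  inertia group (away from `1951` inertia fixes the roots; at `1951` it acts through powers of a
  `5`-cycle, which are even), so by the Kronecker–Weber dictionary of the tree
  (`exists_isPrimitive_dirichletCharacter_eq_dirichletGaloisCharacter`,
  `not_dvd_level_of_isPrimitive_of_forall_mem_inertia`) it is a primitive Dirichlet character whose
  level has no prime divisor, i.e. the trivial character;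
* (ii) **an element of order three**: an arithmetic Frobenius `φ` above `13` permutes the roots by
  `π` with `θ (π i) ≡ (θ i)¹³ (mod 𝔔)`.  The roots are pairwise distinct modulo `𝔔` (Bezout
  certificate `U f + V f' = 207937580000 = 2⁵·5⁴·73²·1951`, `13 ∤` it), and in the computable
  model `QuinticRing (ZMod 13) 12 2 8 0 1 = 𝔽₁₃[t]/(f̄)` the kernel checks `t ^ 13³ = t` and
  `A · (t¹³ − t) = (t − 7)(t − 8)`; pushed to `ℤ̄ ⧸ 𝔔` along `t ↦ θ̄ i` these give `π³ = 1`, and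
  `π = 1` would put all five distinct `θ̄ i` in `{7, 8}`.
-/

set_option linter.dupNamespace false

noncomputable section

open scoped NumberField MatrixGroups
open Field IsDedekindDomain Polynomial
open Literature.NumberTheory.GaloisRepresentations Literature.NumberTheory.PAdicHodge

namespace Summit.Langlands.Langlands.Theorems.QuarterDeficit1951

open Literature.NumberTheory.NumberFields in
/-- `t¹³` in `𝔽₁₃[t]/(f̄)`, `f̄ = t⁵ − t⁴ − 8t² − 2t − 12`. [folklore] -/
private theorem dm_gen_pow_13 :
    QuinticRing.gen (ZMod 13) 12 2 8 0 1 ^ 13 = ⟨10, 9, 8, 7, 3⟩ := by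
  decide +kernel

open Literature.NumberTheory.NumberFields in
/-- `t¹³·¹³` in `𝔽₁₃[t]/(f̄)`. [folklore] -/
private theorem dm_w1_pow_13 :
    (⟨10, 9, 8, 7, 3⟩ : QuinticRing (ZMod 13) 12 2 8 0 1) ^ 13 = ⟨10, 2, 1, 4, 2⟩ := by
  decide +kernel

open Literature.NumberTheory.NumberFields in
/-- `t¹³·¹³·¹³ = t` in `𝔽₁₃[t]/(f̄)`. [folklore] -/
private theorem dm_w2_pow_13 :
    (⟨10, 2, 1, 4, 2⟩ : QuinticRing (ZMod 13) 12 2 8 0 1) ^ 13 =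
      QuinticRing.gen (ZMod 13) 12 2 8 0 1 := by
  decide +kernel

open Literature.NumberTheory.NumberFields in
/-- **`t ^ 13³ = t` in `𝔽₁₃[t]/(f̄)`**: every root of `f̄` in a field of characteristic `13`
lies in `𝔽_{13³}` (`f̄ =` (linear)(linear)(cubic)). [folklore] -/
private theorem dm_gen_pow_2197 :
    QuinticRing.gen (ZMod 13) 12 2 8 0 1 ^ 2197 = QuinticRing.gen (ZMod 13) 12 2 8 0 1 := by
  rw [show 2197 = 13 * 13 * 13 by norm_num, pow_mul, pow_mul, dm_gen_pow_13, dm_w1_pow_13,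
    dm_w2_pow_13]

open Literature.NumberTheory.NumberFields in
/-- **gcd certificate**: `A · (t¹³ − t) = (t − 7)(t − 8)` in `𝔽₁₃[t]/(f̄)` with
`A = 12 + 5t + t²`, i.e. `gcd(t¹³ − t, f̄) ∣ (t − 7)(t − 8)`: the only roots of `f̄` in `𝔽₁₃`
are `7` and `8`. [folklore] -/
private theorem dm_gcd_cert :
    (⟨12, 5, 1, 0, 0⟩ : QuinticRing (ZMod 13) 12 2 8 0 1) *
        (QuinticRing.gen (ZMod 13) 12 2 8 0 1 ^ 13 - QuinticRing.gen (ZMod 13) 12 2 8 0 1) =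
      (QuinticRing.gen (ZMod 13) 12 2 8 0 1 - 7) * (QuinticRing.gen (ZMod 13) 12 2 8 0 1 - 8) := by
  decide +kernel

/-- **Distinct roots congruent modulo an ideal force the derivative into the ideal.** If `a ≠ b`
are roots of `f` over a domain and `a − b ∈ I`, then `f'(a) ∈ I`: with `f = (X − a) h` one has
`h(b) = 0` and `f'(a) = h(a) ≡ h(b) (mod I)`. [folklore] -/
theorem eval_derivative_mem_of_isRoot_of_sub_mem {R : Type*} [CommRing R] [IsDomain R]
    (I : Ideal R) {f : R[X]} {a b : R} (ha : f.IsRoot a) (hb : f.IsRoot b) (hab : a ≠ b)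
    (hI : a - b ∈ I) : f.derivative.eval a ∈ I := by
  set h := f /ₘ (X - C a) with hh
  have hf : (X - C a) * h = f := mul_divByMonic_eq_iff_isRoot.mpr ha
  have hhb : h.eval b = 0 := by
    have hb' : f.eval b = 0 := hb
    rw [← hf, eval_mul, eval_sub, eval_X, eval_C] at hb'
    exact (mul_eq_zero.mp hb').resolve_left (sub_ne_zero.mpr hab.symm)
  have hder : f.derivative.eval a = h.eval a := by
    rw [← hf, derivative_mul, derivative_sub, derivative_X, derivative_C, sub_zero, one_mul,
      eval_add, eval_mul, eval_sub, eval_X, eval_C, sub_self, zero_mul, add_zero]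
  rw [hder, ← sub_zero (h.eval a), ← hhb]
  exact I.mem_of_dvd (sub_dvd_eval_sub a b h) hI

/-- In `S₅`, an element whose fifth power is trivial is even. [folklore] -/
private theorem sign_eq_one_of_pow_five_eq_one {g : Equiv.Perm (Fin 5)} (hg : g ^ 5 = 1) :
    Equiv.Perm.sign g = 1 := by
  have h := congrArg Equiv.Perm.sign hg
  rw [map_pow, map_one] at h
  rcases Int.units_eq_one_or (Equiv.Perm.sign g) with h1 | h1
  · exact h1
  · rw [h1] at h
    exact absurd h (by decide)

/-- **Stub (even image and an element of order three).** (i) The permutation representation on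
the roots is EVEN: `sign ∘ e₀` is a quadratic character of `Γ_ℚ` with open kernel killed by every
inertia group (trivial away from `1951` by the previous stubs, a power of a `5`-cycle at `1951`),
hence trivial (Kronecker–Weber dictionary of the tree: an everywhere unramified Dirichlet character
has conductor `1`). (ii) Some element of `Γ_ℚ` permutes the roots by a permutation of order `3`
(an arithmetic Frobenius above `13`, where `f ≡` (linear)(linear)(irreducible cubic)).
[cite: DoudMoore2006, §4 (Table, p = 1951)] -/
theorem stub_dmEvenOrderThree (θ : Fin 5 → absIntegers (𝓞 ℚ) ℚ)
    (hroot : ∀ i, θ i ^ 5 - θ i ^ 4 - 780 * θ i ^ 3 + 9911 * θ i ^ 2 - 24208 * θ i + 15952 = 0)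
    (hinj : Function.Injective θ)
    (hall : ∀ x : AlgebraicClosure ℚ, x ^ 5 - x ^ 4 - 780 * x ^ 3 + 9911 * x ^ 2 - 24208 * x + 15952 = 0 →
      ∃ i, x = θ i)
    (e₀ : absoluteGaloisGroup ℚ →* Equiv.Perm (Fin 5))
    (he₀ : ∀ (σ : absoluteGaloisGroup ℚ) (i : Fin 5), σ • θ i = θ (e₀ σ i))
    (hopen : IsOpen ((e₀.ker : Subgroup (absoluteGaloisGroup ℚ)) : Set (absoluteGaloisGroup ℚ)))
    (hunr : ∀ v : HeightOneSpectrum (𝓞 ℚ), v.residueCard ≠ 1951 →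
      ∀ 𝔓 ∈ v.primesAbove, ∀ σ ∈ 𝔓.inertia (absoluteGaloisGroup ℚ), ∀ i, σ • θ i = θ i)
    (hloc : ∀ v : HeightOneSpectrum (𝓞 ℚ), v.residueCard = 1951 → ∀ 𝔓 ∈ v.primesAbove,
      ∃ g : Equiv.Perm (Fin 5), orderOf g = 5 ∧
        (𝔓.inertia (absoluteGaloisGroup ℚ)).map e₀ = Subgroup.zpowers g ∧
        (𝔓.decompositionSubgroup (absoluteGaloisGroup ℚ)).map e₀ = Subgroup.zpowers g) :
    (∀ σ : absoluteGaloisGroup ℚ, Equiv.Perm.sign (e₀ σ) = 1) ∧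
      ∃ σ : absoluteGaloisGroup ℚ, e₀ σ ≠ 1 ∧ e₀ σ ^ 3 = 1 := by
  classical
  have _ := hall -- (the completeness of the list of roots is not needed here)
  /- `e₀ σ = 1` as soon as `σ` fixes every root -/
  have htriv : ∀ σ : absoluteGaloisGroup ℚ, (∀ i, σ • θ i = θ i) → e₀ σ = 1 := by
    intro σ hσ
    ext i
    exact congrArg Fin.val (hinj ((he₀ σ i).symm.trans (hσ i)))
  /- PART (i): `sign ∘ e₀` is trivial on every inertia group -/
  have hsignI : ∀ (v : HeightOneSpectrum (𝓞 ℚ)), ∀ 𝔓 ∈ v.primesAbove,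
      ∀ σ ∈ 𝔓.inertia (absoluteGaloisGroup ℚ), Equiv.Perm.sign (e₀ σ) = 1 := by
    intro v 𝔓 h𝔓 σ hσ
    by_cases hv : v.residueCard = 1951
    · obtain ⟨g, hg, hI, -⟩ := hloc v hv 𝔓 h𝔓
      have hmem : e₀ σ ∈ Subgroup.zpowers g := by
        rw [← hI]
        exact Subgroup.mem_map_of_mem e₀ hσ
      obtain ⟨k, hk⟩ := Subgroup.mem_zpowers_iff.mp hmem
      have hg5 : g ^ 5 = 1 := by
        have h := pow_orderOf_eq_one g
        rwa [hg] at h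
      rw [← hk, map_zpow, sign_eq_one_of_pow_five_eq_one hg5, one_zpow]
    · rw [htriv σ (hunr v hv 𝔓 h𝔓 σ hσ), map_one]
  set ψ : absoluteGaloisGroup ℚ →* ℂˣ :=
    (Units.map ((Int.castRingHom ℂ : ℤ →+* ℂ) : ℤ →* ℂ)).comp (Equiv.Perm.sign.comp e₀) with hψdef
  have hψapply : ∀ σ, ((ψ σ : ℂˣ) : ℂ) = (((Equiv.Perm.sign (e₀ σ) : ℤˣ) : ℤ) : ℂ) := fun σ => rfl
  have hψker :
      IsOpen ((ψ.ker : Subgroup (absoluteGaloisGroup ℚ)) : Set (absoluteGaloisGroup ℚ)) := by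
    refine Subgroup.isOpen_mono ?_ hopen
    intro σ hσ
    rw [MonoidHom.mem_ker] at hσ ⊢
    rw [hψdef, MonoidHom.comp_apply, MonoidHom.comp_apply, hσ, map_one, map_one]
  obtain ⟨N, hN, χ, hχ, hψχ⟩ :=
    exists_isPrimitive_dirichletCharacter_eq_dirichletGaloisCharacter ψ hψker
  -- the level has no prime divisor
  have hN1 : N = 1 := by
    by_contra hN1
    obtain ⟨p, hp, hpN⟩ := Nat.exists_prime_and_dvd hN1
    set v : HeightOneSpectrum (𝓞 ℚ) :=
      (Rat.HeightOneSpectrum.primesEquiv (R := 𝓞 ℚ)).symm ⟨p, hp⟩ with hvdef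
    have hv : ((p : ℕ) : 𝓞 ℚ) ∈ v.asIdeal :=
      (Literature.NumberTheory.EllipticCurves.natCast_mem_asIdeal_iff_eq_primesEquiv_symm v hp).mpr
        rfl
    obtain ⟨𝔓, h𝔓⟩ := HeightOneSpectrum.primesAbove_nonempty v
    refine not_dvd_level_of_isPrimitive_of_forall_mem_inertia hχ hp hv h𝔓 (fun τ hτ => ?_) hpN
    rw [← hψχ τ, hψapply, hsignI v 𝔓 h𝔓 τ hτ, Units.val_one, Int.cast_one]
  subst hN1
  have hsign : ∀ σ, Equiv.Perm.sign (e₀ σ) = 1 := by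
    intro σ
    have h := hψχ σ
    rw [hψapply, DirichletCharacter.level_one χ, coe_dirichletGaloisCharacter_apply,
      MulChar.one_apply_coe, Int.cast_eq_one, Units.val_eq_one] at h
    exact h
  refine ⟨hsign, ?_⟩
  /- PART (ii): an arithmetic Frobenius above `13` -/
  have hp13 : Nat.Prime 13 := by norm_num
  set v : HeightOneSpectrum (𝓞 ℚ) :=
    (Rat.HeightOneSpectrum.primesEquiv (R := 𝓞 ℚ)).symm ⟨13, hp13⟩ with hvdef
  have hv : ((13 : ℕ) : 𝓞 ℚ) ∈ v.asIdeal :=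
    (Literature.NumberTheory.EllipticCurves.natCast_mem_asIdeal_iff_eq_primesEquiv_symm v hp13).mpr
      rfl
  have hres : v.residueCard = 13 := Rat.residueCard_eq_of_natCast_mem hp13 hv
  obtain ⟨𝔔, h𝔔⟩ := HeightOneSpectrum.primesAbove_nonempty v
  obtain ⟨φ, hφ⟩ := HeightOneSpectrum.exists_isArithFrobAt_of_mem_primesAbove_holds h𝔔
  rw [HeightOneSpectrum.isArithFrobAt_iff_of_mem_primesAbove h𝔔, hres] at hφ
  haveI h𝔔p : 𝔔.IsPrime := h𝔔.1
  have h13 : ((13 : ℕ) : absIntegers (𝓞 ℚ) ℚ) ∈ 𝔔 := by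
    have h := hv
    rw [h𝔔.2.over, Ideal.mem_under, map_natCast] at h
    exact h
  have hNmem : ((207937580000 : ℕ) : absIntegers (𝓞 ℚ) ℚ) ∉ 𝔔 :=
    Rat.natCast_not_mem_of_natCast_mem_of_not_dvd hp13 (by norm_num) hv h𝔔
  -- the residue ring `Q = ℤ̄ ⧸ 𝔔`, a domain of characteristic `13`
  set Q := absIntegers (𝓞 ℚ) ℚ ⧸ 𝔔 with hQdef
  set mk : absIntegers (𝓞 ℚ) ℚ →+* Q := Ideal.Quotient.mk 𝔔 with hmkdef
  have h13Q : (13 : Q) = 0 := by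
    have h := (Ideal.Quotient.eq_zero_iff_mem.mpr h13)
    rw [map_natCast] at h
    exact_mod_cast h
  haveI : CharP Q 13 := (CharP.charP_iff_prime_eq_zero hp13).mpr (by exact_mod_cast h13Q)
  set θb : Fin 5 → Q := fun i => mk (θ i) with hθbdef
  -- (A) the roots are pairwise distinct modulo `𝔔`
  set fP : (absIntegers (𝓞 ℚ) ℚ)[X] :=
    X ^ 5 - X ^ 4 - C 780 * X ^ 3 + C 9911 * X ^ 2 - C 24208 * X + C 15952 with hfPdef
  have hfP : ∀ i, fP.IsRoot (θ i) := by
    intro i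
    simp only [hfPdef, IsRoot.def, eval_add, eval_sub, eval_mul, eval_pow, eval_X, eval_C]
    exact hroot i
  have hfP' : ∀ x, fP.derivative.eval x =
      5 * x ^ 4 - 4 * x ^ 3 - 2340 * x ^ 2 + 19822 * x - 24208 := by
    intro x
    simp only [hfPdef, derivative_add, derivative_sub, derivative_mul, derivative_X_pow,
      derivative_X, derivative_C, eval_add, eval_sub, eval_mul, eval_pow, eval_X, eval_C,
      eval_zero, zero_mul, zero_add, mul_one]
    push_cast
    ring
  have hθb : Function.Injective θb := by
    intro i j hij
    by_contra hne
    have hsub : θ i - θ j ∈ 𝔔 := Ideal.Quotient.eq.mp hij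
    have hder := eval_derivative_mem_of_isRoot_of_sub_mem 𝔔 (hfP i) (hfP j) (hinj.ne hne) hsub
    rw [hfP'] at hder
    apply hNmem
    have key : ((207937580000 : ℕ) : absIntegers (𝓞 ℚ) ℚ) =
        (-380679762 + 54956716 * θ i - 105004 * θ i ^ 2 - 118395 * θ i ^ 3) *
          (θ i ^ 5 - θ i ^ 4 - 780 * θ i ^ 3 + 9911 * θ i ^ 2 - 24208 * θ i + 15952) +
        (-259440728 + 204458489 * θ i - 18387180 * θ i ^ 2 + 16265 * θ i ^ 3 + 23679 * θ i ^ 4) *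
          (5 * θ i ^ 4 - 4 * θ i ^ 3 - 2340 * θ i ^ 2 + 19822 * θ i - 24208) := by
      push_cast
      ring
    rw [key]
    exact 𝔔.add_mem (𝔔.mul_mem_left _ (by rw [hroot i]; exact 𝔔.zero_mem)) (𝔔.mul_mem_left _ hder)
  -- (B) Frobenius: `θ̄ (π i) = (θ̄ i) ^ 13`
  have hFrob : ∀ i, θb (e₀ φ i) = θb i ^ 13 := by
    intro i
    have h := hφ (θ i)
    rw [he₀ φ i] at h
    show mk (θ (e₀ φ i)) = mk (θ i) ^ 13
    rw [← map_pow]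
    exact Ideal.Quotient.eq.mpr h
  -- (C) the model `𝔽₁₃[t]/(f̄) → Q`, `t ↦ θ̄ i`
  have hΦ : ∀ i, ∃ Φ : Literature.NumberTheory.NumberFields.QuinticRing (ZMod 13) 12 2 8 0 1 →+* Q,
      Φ (Literature.NumberTheory.NumberFields.QuinticRing.gen (ZMod 13) 12 2 8 0 1) = θb i := by
    intro i
    have hf :
        θb i ^ 5 - θb i ^ 4 - 780 * θb i ^ 3 + 9911 * θb i ^ 2 - 24208 * θb i + 15952 = 0 := by
      have h := congrArg mk (hroot i)
      simp only [map_add, map_sub, map_mul, map_pow, map_ofNat, map_zero] at h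
      exact h
    have hev : (Literature.NumberTheory.NumberFields.QuinticRing.poly (12 : ZMod 13) 2 8 0 1).eval₂
        (ZMod.castHom (dvd_refl 13) Q) (θb i) = 0 := by
      simp only [Literature.NumberTheory.NumberFields.QuinticRing.poly, eval₂_sub, eval₂_mul,
        eval₂_C, eval₂_X_pow, eval₂_X]
      simp only [map_one, map_zero, map_ofNat]
      linear_combination hf - (-60 * θb i ^ 3 + 763 * θb i ^ 2 - 1862 * θb i + 1228) * h13Q
    refine ⟨(AdjoinRoot.lift (ZMod.castHom (dvd_refl 13) Q) (θb i) hev).comp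
      Literature.NumberTheory.NumberFields.QuinticRing.toAdjHom, ?_⟩
    rw [RingHom.comp_apply, Literature.NumberTheory.NumberFields.QuinticRing.toAdjHom_apply,
      Literature.NumberTheory.NumberFields.QuinticRing.toAdj_gen, AdjoinRoot.lift_root]
  have hpow : ∀ i, θb i ^ 2197 = θb i := by
    intro i
    obtain ⟨Φ, hΦi⟩ := hΦ i
    have h := congrArg Φ dm_gen_pow_2197
    rwa [map_pow, hΦi] at h
  have hfix : ∀ i, θb i ^ 13 = θb i → θb i = 7 ∨ θb i = 8 := by
    intro i hi
    obtain ⟨Φ, hΦi⟩ := hΦ i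
    have h := congrArg Φ dm_gcd_cert
    simp only [map_mul, map_sub, map_pow, hΦi, map_ofNat, hi, sub_self, mul_zero] at h
    rcases mul_eq_zero.mp h.symm with h7 | h8
    · exact Or.inl (sub_eq_zero.mp h7)
    · exact Or.inr (sub_eq_zero.mp h8)
  refine ⟨φ, fun h1 => ?_, Equiv.ext fun i => hθb ?_⟩
  · -- `π ≠ 1`: otherwise all five distinct `θ̄ i` lie in `{7, 8}`
    have hall78 : ∀ i, θb i = 7 ∨ θb i = 8 := fun i =>
      hfix i (by rw [← hFrob, h1, Equiv.Perm.coe_one, id_eq])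
    have hsub : Finset.univ.image θb ⊆ {7, 8} := by
      intro x hx
      obtain ⟨i, -, rfl⟩ := Finset.mem_image.mp hx
      rcases hall78 i with h | h <;> simp [h]
    have hcard := Finset.card_le_card hsub
    rw [Finset.card_image_of_injective _ hθb, Finset.card_univ, Fintype.card_fin] at hcard
    exact absurd (hcard.trans Finset.card_le_two) (by norm_num)
  · -- `π ^ 3 = 1`
    rw [Equiv.Perm.coe_pow, Function.iterate_succ, Function.iterate_succ, Function.iterate_succ,
      Function.iterate_zero, Function.comp_apply, Function.comp_apply, Function.comp_apply, id_eq,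
      Equiv.Perm.coe_one, id_eq, hFrob, hFrob, hFrob, ← pow_mul, ← pow_mul]
    exact hpow i

end Summit.Langlands.Langlands.Theorems.QuarterDeficit1951

end
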